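import Summits.NavierStokesRegularity.NavierStokesRegularity.Theses.DssFarFieldSlaving
import Literature.Analysis.FluidPDE.TypeIAncientMild
import Literature.Analysis.FluidPDE.ChaeWolfDSSDecayLtNine

/-!
# Line `dss_cell` for crux `BlowupTypeIDssProfile` (stmt-NavierStokesRegularity-0155)
# — routes `DssFarFieldSlaving` (#5) and `Blowup` (#5), summit NavierStokesRegularity (negative side)
# STRATEGIST LINE (crux-strategist seat `cstrat-stmt-NavierStokesRegularity-0155-s2`, 2026-08-17)

The crux is `¬ (∀ c, TypeIDSSLiouville c ∧ ∀ R, RotatedTypeIDSSLiouville c R)` — the failure of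
Tsai's Type-I (rotated) `λ`-DSS Liouville conjecture (Tsai GSM 192 Conj. 8.8–8.9 = Bradshaw–Tsai
2017 Open Problem 5.1 = Pineau–Vicol 2026 §1.3–1.4): a NONTRIVIAL Type-I `λ`-DSS (or rotated DSS)
ancient mild solution EXISTS. Since `DssTruncationBridge` is PROVED in tree
(`Theorems.dssTruncationBridge_proof`, through `filamentSkeletonRss_rdssProfileTruncation_proof`),
this item alone decides `¬NavierStokesRegularity` through the route's `closes`; it is the sink of
every negative-side profile crux of the summit (`QuantisedSymmetry.PolyhedralDssProfileExists`,
`QuarterTurnRdss.QuarterTurnProfileExists`, `FilamentSkeletonRss.RssProfileExists`,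
`CorkscrewDynamo.CorkscrewProfile`, `CirculationRelay.OhRelayProfileExists`,
`MirrorChamber.ChamberDssProfile`, … — each implies it in ≤ 6 lines).

This line is the SECTOR-FREE period-cell frame: the transfer to the bare crux of the sibling
strategist lines `Cruxes/PolyhedralDssProfileExists/Lines/polyhedral_cell.lean` (stmt-1404) and
`Cruxes/QuarterTurnProfileExists/Lines/period_cell.lean` (stmt-1100). A `λ`-DSS ancient solution is
the ℤ-orbit, under the zoom `(𝒮h)(x) = λ h(λx)`, of its restriction to ONE model period
`[-1, -λ⁻²] × ℝ³`; that restriction is a **cell** — jointly continuous, bounded, weakly divergence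
free, Oseen-mild between all pairs of model times (the KNSS gauge, which excludes the parasitic
`b(t)`), closing up under the zoom: `v(-λ⁻², x) = λ v(-1, λx)` — a FIXED POINT of the
renormalisation map `𝓡 = 𝒮⁻¹ ∘ Φ_NS(1 − λ⁻²)` on bounded continuous solenoidal fields. The ∀-side
of the frame is entirely in tree: Chae–Wolf 2017 Thm 1.1 for slices in `L^q`, `3 ≤ q < 9`
(`Literature.Analysis.FluidPDE.chaeWolf2017_dss_typeI_decay_of_lt_nine`, PROVED) supplies the
Type-I space–time bound of the concatenated field once the cell's datum lies in `L⁴` (harmless for a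
constructor: a Type-I profile slice is `O(1/(1+‖x‖)) ∈ L⁴`), and the KNSS gauge
(`IsTypeIAncientMild.isAncientMildSolution`, `.aestronglyMeasurable_slice`) supplies the
duality-form ancient-mild class of the wall. Hence exactly ONE open stub:

* `stub_dssCellExists` (XL, open; the ∃-side — the whole constructive content of the crux, in
  strictly cheaper clothes): some `c > 1` admits a cell whose datum `v(-1)` is in `L⁴` and not a.e.
  zero. NO symmetry, NO spatial decay, NO ancientness, NO duality-mildness, NO smoothness is asked.
  It is the WEAKEST cell statement in the tree: a `G`-cell of `polyhedral_cell` is a cell (drop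
  `G`); a finite-order twisted cell (quarter-turn, any rotation `R` with `Rᵐ = 1`) concatenated over
  `m` periods is a plain cell with factor `cᵐ`; an RSS profile of speed `α`
  (`FilamentSkeletonRss.RssProfileExists`) restricted to `[-1, -c⁻²]` with `c = e^{π/|α|}` is a plain
  cell (Pineau–Vicol 2026 Remark 1.5). Why easier than the crux (same three reasons as the siblings,
  which hold verbatim without symmetry): (i) a FINITE-time two-point problem for the Navier–Stokes
  flow itself — one explicit map on one space, whose residual `𝓡(v₀) − v₀` any Navier–Stokes
  integrator evaluates (Newton–Krylov shooting; dynamic-rescaling diagnostics); (ii) the sup norm is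
  SUBCRITICAL, `‖𝒮⁻¹h‖_∞ = λ⁻¹‖h‖_∞`, so `D𝓡` = (norm `λ⁻¹`) + (compact Duhamel part) is
  quasi-compact — the structure PROVED and exploited in
  `Theorems/FilamentSkeletonRssRdssProfileTruncation*` (`stub_rdssSlabFlow`, `stub_rdssPeriodPackage`,
  `stub_pseudoStableSteering`) — hence `I − D𝓡` is Fredholm of index `0`, non-degeneracy is a
  point-spectrum condition and Newton–Kantorovich certification is well posed, whereas in every
  profile-weighted space of the similarity variables the far field `|y|^{-1∓2iω}σ(ŷ)` of
  `𝓛 = Δ − ½y·∇ − ½` is essential spectrum ON the imaginary axis; (iii) the log-periodic algebraic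
  DSS tail is OUTPUT (Chae–Wolf Thm 1.1), not input.
* `stub_dssCellConcatenates` (L, provable from tree engines; the bridge): a cell with `L⁴` datum
  concatenates (two-sided ℤ-chain of zooms; `oseen_zoom_shift`, `oseenMild_glue/chain`,
  `exists_concatenation_of_periodic_slabs` with `R = 1`) to an Oseen-mild ancient `c`-DSS field with
  the same slice at `t = -1`, classical on `(-∞,0)` with a pressure (KNSS 2009 Prop. 4.1 =
  `KNSS2009_prop41_mild_holds`; `classical_of_smooth_isMildNSSolutionOn_holds`), slices in `L⁴`,
  continuous in `L⁴`. It is the `G = ⊥` instance of `polyhedral_cell`'s `stub_cellConcatenatesToDss`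
  (stmt-1404): ONE proof serves both (instantiate `G := ⊥`, or copy it dropping the equivariance
  clause); it carries a different name here so that the two landed theorems never clash.

Composition `BlowupTypeIDssProfile_of` (kernel-checked, no `sorry`): stub 2 gives `(u, p)`;
Chae–Wolf at `q = 4` gives `HasTypeIDecay C u`; with `C' = max C 1 ≥ 0` the field is
`IsTypeIAncientMild C' u`, hence an ancient mild solution with measurable slices; assuming the wall
`∀ c, TypeIDSSLiouville c ∧ …`, its FIRST conjunct at the cell's factor `c` makes every slice a.e.
zero, contradicting `u(-1) = v(-1) ≠ 0` a.e.

Disproof used: none — no `Disproof.lean` / Negative lemma is filed for this crux (`ledger crux ls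
stmt-NavierStokesRegularity-0155`, 2026-08-17T08Z: no workfiles). Known removals honoured (all are
constraints INSIDE stub 1, which asks no smallness, no axis, no steadiness, no nearness to `λ = 1`):
Chae–Wolf 2017 Thm 1.3 / Pineau–Vicol Thm 1.6 (`c ≥ λ_*(C₀)`; tree `chaeWolf2017_removing_dss`),
Gustafson–Kang–Tsai ε-regularity / `ExtremalTypeIConstant.SmallConstantLiouville` (PROVED: cells
are LARGE, `sup √(−t)|u| ≥ c₀ = 1/(πκ)`), Tsai 1998 (no steady cell), Seregin–Šverák 2009 / KNSS
Thm 5.3 (no axisymmetric cell), KNSS 2-D Liouville (no planar cell), Pineau–Vicol Thm 1.4 (an RSS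
cell has `α_(C₀) ≤ |α| ≤ ᾱ(C₀)`); the refuted statements of `ledger negatives --problem
NavierStokesRegularity` are not instances of either stub.
-/

noncomputable section

namespace Summit.NavierStokesRegularity.NavierStokesRegularity.Cruxes.BlowupTypeIDssProfile.DssCell

open MeasureTheory Set Function Filter Topology
open Literature.Analysis.FluidPDE

set_option linter.dupNamespace false

/-! ## The two statements of the line (named, so that the composition's hypotheses are keyed by name) -/

/-- **Statement of stub 1 (∃-side): a `c`-DSS period cell with `L⁴` datum exists.** -/
def DssCellExists : Prop :=
  ∃ c : ℝ, 1 < c ∧ ∃ v : ℝ → EuclideanSpace ℝ (Fin 3) → EuclideanSpace ℝ (Fin 3),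
    (ContinuousOn (Function.uncurry v) (Set.Icc (-1 : ℝ) (-(c ^ 2)⁻¹) ×ˢ Set.univ) ∧
      (∃ M : ℝ, ∀ t ∈ Set.Icc (-1 : ℝ) (-(c ^ 2)⁻¹), ∀ x, ‖v t x‖ ≤ M) ∧
      (∀ t ∈ Set.Icc (-1 : ℝ) (-(c ^ 2)⁻¹), IsWeaklyDivFree (v t)) ∧
      (∀ s t : ℝ, -1 ≤ s → s < t → t ≤ -(c ^ 2)⁻¹ → ∀ x,
        v t x = heatFlow (v s) (t - s) x - oseenDuhamel 1 s v v t x) ∧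
      (∀ x, v (-(c ^ 2)⁻¹) x = c • v (-1) (c • x))) ∧
    MemLp (v (-1)) 4 volume ∧ ¬ (v (-1) =ᵐ[volume] 0)

/-- **Statement of stub 2 (bridge): a cell with `L⁴` datum concatenates to a classical, Oseen-mild,
`c`-DSS ancient field with `L⁴`-continuous slices.** -/
def DssCellConcatenates : Prop :=
  ∀ (c : ℝ), 1 < c → ∀ v : ℝ → EuclideanSpace ℝ (Fin 3) → EuclideanSpace ℝ (Fin 3),
    (ContinuousOn (Function.uncurry v) (Set.Icc (-1 : ℝ) (-(c ^ 2)⁻¹) ×ˢ Set.univ) ∧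
      (∃ M : ℝ, ∀ t ∈ Set.Icc (-1 : ℝ) (-(c ^ 2)⁻¹), ∀ x, ‖v t x‖ ≤ M) ∧
      (∀ t ∈ Set.Icc (-1 : ℝ) (-(c ^ 2)⁻¹), IsWeaklyDivFree (v t)) ∧
      (∀ s t : ℝ, -1 ≤ s → s < t → t ≤ -(c ^ 2)⁻¹ → ∀ x,
        v t x = heatFlow (v s) (t - s) x - oseenDuhamel 1 s v v t x) ∧
      (∀ x, v (-(c ^ 2)⁻¹) x = c • v (-1) (c • x))) →
    MemLp (v (-1)) 4 volume →
    ∃ (u : ℝ → EuclideanSpace ℝ (Fin 3) → EuclideanSpace ℝ (Fin 3))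
      (p : ℝ → EuclideanSpace ℝ (Fin 3) → ℝ),
      IsClassicalNSSolutionOn (Set.Iio 0) 1 0 u p ∧ IsDiscretelySelfSimilar c u ∧
      u (-1) = v (-1) ∧
      (∀ s t : ℝ, s < t → t < 0 → ∀ x, u t x = heatFlow (u s) (t - s) x - oseenDuhamel 1 s u u t x) ∧
      (∀ t < 0, MemLp (u t) 4 volume) ∧
      (∀ t₀ < 0, Filter.Tendsto (fun t => eLpNorm (u t - u t₀) 4 volume)
        (nhdsWithin t₀ (Set.Iio 0)) (nhds 0))

namespace Registered

/-- Alias of `DssCellExists` keyed by the registered stub name. -/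
abbrev stub_dssCellExists : Prop := DssCellExists
/-- Alias of `DssCellConcatenates` keyed by the registered stub name. -/
abbrev stub_dssCellConcatenates : Prop := DssCellConcatenates

end Registered

/-! ## Registered stubs (the ONLY `sorry`s of the file; literal signatures) -/

/-- **Stub 1 (XL, open; ∃-side): a DSS period cell.** There are a factor `c > 1` and a field `v`
on the model period `[-1, -c⁻²] × ℝ³`, jointly continuous, bounded, weakly divergence free,
Oseen-mild between all pairs of model times, closing up under the zoom (`v(-c⁻², x) = c v(-1, cx)`),
with datum `v(-1) ∈ L⁴` not a.e. zero. Equivalently: a nontrivial fixed point, with `L⁴` tail, of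
the renormalisation map `𝓡 = 𝒮_c⁻¹ ∘ Φ_NS(1 − c⁻²)` on bounded continuous solenoidal fields.
Why it might fail: Tsai's Type-I DSS Liouville conjecture may hold (then, by stub 2 + Chae–Wolf Thm
1.1, no such cell); `c < λ_*(C₀)` is removed (Chae–Wolf Thm 1.3 / Pineau–Vicol Thm 1.6), small cells
are removed (ε-regularity; `SmallConstantLiouville`), steady / axisymmetric / planar / RSS with
`|α| ≪ 1` or `≫ 1` cells are removed (Tsai 1998, Seregin–Šverák 2009, KNSS 2009, Pineau–Vicol
Thm 1.4); every numerical search on record (2001 programme: ~25 seed topologies, `C₀ ≤ 1400`;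
Kida–Pelz octahedral; Moffatt–Kimura rings) decayed, folded or saturated.
[sources: BradshawTsai2017CPDE §1, §5 Open Problem 5.1; ChaeWolf2017RemovingDSS Def. 1.1, Thm 1.1, Thm 1.3, Rem. 1.4; Tsai2018 Conj. 8.8–8.9; PineauVicol2026 (arXiv:2607.09619) §1.3 p. 6 ("Not much seems to be known about the existence of solutions to (1.12)"), Thms 1.4, 1.6, 1.7; KNSS2009 §4] -/
theorem stub_dssCellExists :
    ∃ c : ℝ, 1 < c ∧ ∃ v : ℝ → EuclideanSpace ℝ (Fin 3) → EuclideanSpace ℝ (Fin 3),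
    (ContinuousOn (Function.uncurry v) (Set.Icc (-1 : ℝ) (-(c ^ 2)⁻¹) ×ˢ Set.univ) ∧
      (∃ M : ℝ, ∀ t ∈ Set.Icc (-1 : ℝ) (-(c ^ 2)⁻¹), ∀ x, ‖v t x‖ ≤ M) ∧
      (∀ t ∈ Set.Icc (-1 : ℝ) (-(c ^ 2)⁻¹), IsWeaklyDivFree (v t)) ∧
      (∀ s t : ℝ, -1 ≤ s → s < t → t ≤ -(c ^ 2)⁻¹ → ∀ x,
        v t x = heatFlow (v s) (t - s) x - oseenDuhamel 1 s v v t x) ∧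
      (∀ x, v (-(c ^ 2)⁻¹) x = c • v (-1) (c • x))) ∧
    MemLp (v (-1)) 4 volume ∧ ¬ (v (-1) =ᵐ[volume] 0) := by
  sorry

/-- **Stub 2 (L, provable; bridge): a cell with `L⁴` datum concatenates to a classical, Oseen-mild,
`c`-DSS ancient field.** Proof route: two-sided ℤ-concatenation `u(t, x) = cᵏ v(c^{2k}t, cᵏx)` on
`t ∈ [-c^{-2k}, -c^{-2k-2}]`, `k ∈ ℤ`, `u = 0` for `t ≥ 0`; joint continuity and Oseen-mildness
between all pairs `s < t < 0` by zoom covariance on each slab (`oseen_zoom_shift`) and gluing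
across slabs (`oseenMild_glue`, `oseenMild_chain`, as in `exists_concatenation_of_periodic_slabs`
with `R = 1`); `c`-DSS on all of `ℝ` (both sides vanish for `t ≥ 0`); slices in `L⁴` on the period
by the mild formula from `v(-1) ∈ L⁴ ∩ L^∞` (heat semigroup bounded and strongly continuous on
`L⁴`, Duhamel term `≲ √(t-s) ‖v‖_∞ sup ‖v(τ)‖_{L⁴}`), on every slab by scaling
(`‖u(t)‖_{L⁴} = c^{k/4}‖v(c^{2k}t)‖_{L⁴}`), `L⁴`-continuity likewise (junctions match exactly);
classical smoothness with a pressure by KNSS 2009 Prop. 4.1 (`KNSS2009_prop41_mild_holds`: bounded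
Oseen-mild on a slab ⇒ jointly `C^∞` after the initial time — every negative time is interior for
an ancient field) and `classical_of_smooth_isMildNSSolutionOn_holds` (smooth mild ⇒ classical with
the Riesz pressure). The `G = ⊥` instance of `polyhedral_cell`'s `stub_cellConcatenatesToDss`
(stmt-NavierStokesRegularity-1404): one proof serves both.
Why it might fail (Lean only): ℤ-indexed slab bookkeeping; the `L⁴` propagation needs the Oseen
kernel `L¹` bound per unit time (`exists_lintegral_enorm_oseenKernel_le`).
[sources: BradshawTsai2017CPDE §1; ChaeWolf2017RemovingDSS Def. 1.1, §4; KNSS2009 §4 Prop. 4.1, §6; tree RdssPeriodConcatenation.lean, OseenMildSlabChain.lean, KNSSProp41MildHolds.lean, NSBoundedMildOseenClassical.lean] -/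
theorem stub_dssCellConcatenates :
    ∀ (c : ℝ), 1 < c → ∀ v : ℝ → EuclideanSpace ℝ (Fin 3) → EuclideanSpace ℝ (Fin 3),
    (ContinuousOn (Function.uncurry v) (Set.Icc (-1 : ℝ) (-(c ^ 2)⁻¹) ×ˢ Set.univ) ∧
      (∃ M : ℝ, ∀ t ∈ Set.Icc (-1 : ℝ) (-(c ^ 2)⁻¹), ∀ x, ‖v t x‖ ≤ M) ∧
      (∀ t ∈ Set.Icc (-1 : ℝ) (-(c ^ 2)⁻¹), IsWeaklyDivFree (v t)) ∧
      (∀ s t : ℝ, -1 ≤ s → s < t → t ≤ -(c ^ 2)⁻¹ → ∀ x,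
        v t x = heatFlow (v s) (t - s) x - oseenDuhamel 1 s v v t x) ∧
      (∀ x, v (-(c ^ 2)⁻¹) x = c • v (-1) (c • x))) →
    MemLp (v (-1)) 4 volume →
    ∃ (u : ℝ → EuclideanSpace ℝ (Fin 3) → EuclideanSpace ℝ (Fin 3))
      (p : ℝ → EuclideanSpace ℝ (Fin 3) → ℝ),
      IsClassicalNSSolutionOn (Set.Iio 0) 1 0 u p ∧ IsDiscretelySelfSimilar c u ∧
      u (-1) = v (-1) ∧
      (∀ s t : ℝ, s < t → t < 0 → ∀ x, u t x = heatFlow (u s) (t - s) x - oseenDuhamel 1 s u u t x) ∧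
      (∀ t < 0, MemLp (u t) 4 volume) ∧
      (∀ t₀ < 0, Filter.Tendsto (fun t => eLpNorm (u t - u t₀) 4 volume)
        (nhdsWithin t₀ (Set.Iio 0)) (nhds 0)) := by
  sorry

/-! ## Composition (kernel-checked; no `sorry` in the closure of `BlowupTypeIDssProfile_of`) -/

/-- `ENNReal.ofReal 4 = 4` (the exponent of Chae–Wolf Thm 1.1 at `q = 4`). -/
theorem ofReal_four : ENNReal.ofReal (4 : ℝ) = (4 : ENNReal) := by
  have h : ((4 : NNReal) : ENNReal) = (4 : ENNReal) := by norm_num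
  rw [← h, ← ENNReal.ofReal_coe_nnreal]
  norm_num

/-- **Composition: the two stubs imply the crux `DssFarFieldSlaving.BlowupTypeIDssProfile` BY NAME**
(= `Blowup.BlowupTypeIDssProfile` = stmt-NavierStokesRegularity-0155, `Iff.rfl`). Hypotheses keyed
by the registered stub names (`Registered.stub_X`, `rfl`-equal to the literal stub signatures).
The witness is the concatenated field `u` of stub 2; its Type-I bound is Chae–Wolf 2017 Thm 1.1 at
`q = 4` (tree theorem `chaeWolf2017_dss_typeI_decay_of_lt_nine`), its duality-mildness the KNSS gauge
`IsTypeIAncientMild.isAncientMildSolution`; the wall's FIRST conjunct (`TypeIDSSLiouville c`, plain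
DSS) at the cell's factor is contradicted at the slice `t = -1`. -/
theorem BlowupTypeIDssProfile_of (h₁ : Registered.stub_dssCellExists)
    (h₂ : Registered.stub_dssCellConcatenates) :
    _root_.Summit.NavierStokesRegularity.NavierStokesRegularity.Theses.DssFarFieldSlaving.BlowupTypeIDssProfile := by
  dsimp only [Registered.stub_dssCellExists, DssCellExists,
    Registered.stub_dssCellConcatenates, DssCellConcatenates] at h₁ h₂
  obtain ⟨c, hc, v, hcell, hL4, hnt⟩ := h₁
  obtain ⟨u, p, hcl, hdss, hu1, hmild, hL4u, hcont⟩ := h₂ c hc v hcell hL4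
  -- Chae–Wolf 2017 Thm 1.1 at q = 4: the Type-I space–time bound
  obtain ⟨C, hC⟩ := chaeWolf2017_dss_typeI_decay_of_lt_nine 4 (by norm_num) (by norm_num) c hc u p hcl
    (fun t ht => by rw [ofReal_four]; exact hL4u t ht)
    (fun t₀ ht₀ => by rw [ofReal_four]; exact hcont t₀ ht₀) hdss
  -- a nonnegative Type-I constant
  have hC' : HasTypeIDecay (max C 1) u := fun t ht x =>
    (hC t ht x).trans (div_le_div_of_nonneg_right (le_max_left C 1)
      (add_nonneg (norm_nonneg x) (Real.sqrt_nonneg _)))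
  have hC'0 : (0 : ℝ) ≤ max C 1 := zero_le_one.trans (le_max_right C 1)
  -- the KNSS gauge class
  have hK : IsTypeIAncientMild (max C 1) u :=
    ⟨hcl.smooth_velocity, fun t ht => hcl.divFree t ht, hmild, hC'.hasTypeITimeDecay hC'0⟩
  -- unfold the crux: the wall fails
  intro hwall
  have hzero : ∀ t < 0, u t =ᵐ[volume] 0 :=
    (hwall c).1 hc u hK.isAncientMildSolution (fun t ht => hK.aestronglyMeasurable_slice ht) hdss
      ⟨max C 1, hC'⟩
  -- nontriviality transfers through the slice `u(-1) = v(-1)`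
  apply hnt
  have h1 := hzero (-1) (by norm_num)
  rwa [hu1] at h1

/-! ## Wiring check -/

/-- A local copy of the crux (so that exactly ONE theorem of this file concludes the crux constant itself). -/
def BlowupTypeIDssProfile' : Prop :=
  _root_.Summit.NavierStokesRegularity.NavierStokesRegularity.Theses.DssFarFieldSlaving.BlowupTypeIDssProfile

/-- The sorried stubs, with their LITERAL signatures, feed `BlowupTypeIDssProfile_of` exactly as
stated (this declaration inherits the two `sorry`s through them; `BlowupTypeIDssProfile_of` itself
is closed: axioms `propext, Classical.choice, Quot.sound`). -/
theorem blowupTypeIDssProfile_of_stubs : BlowupTypeIDssProfile' :=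
  BlowupTypeIDssProfile_of stub_dssCellExists stub_dssCellConcatenates

/-- The same composition also yields route `Blowup`'s copy of the crux (one ledger item, two
decls, `Iff.rfl`); closed implication, no `sorry` in its cone. -/
theorem blowup_copy_of (h₁ : Registered.stub_dssCellExists)
    (h₂ : Registered.stub_dssCellConcatenates) :
    _root_.Summit.NavierStokesRegularity.NavierStokesRegularity.Theses.Blowup.BlowupTypeIDssProfile :=
  BlowupTypeIDssProfile_of h₁ h₂

end Summit.NavierStokesRegularity.NavierStokesRegularity.Cruxes.BlowupTypeIDssProfile.DssCell

end
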